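import Mathlib
import HarnessLib
import Summits.HubbardSuperconductivity.HubbardSuperconductivity.Theorems.KLProgrammeKLRegimeEngineTowerWtAssemblyKlEngClosedSharp4C2
import Summits.HubbardSuperconductivity.HubbardSuperconductivity.Theorems.KLProgrammeKLRegimeEngineTowerWtAssemblyKlEngFinal
import Summits.HubbardSuperconductivity.HubbardSuperconductivity.Theorems.KLProgrammeKLRegimeEngineScaleOneDatumWtKlEng

/-!
# ♯4 RE-THREAD, FILE F″ — THE HEAD (on E″/D″ = the (R431) two-leg-cell twins): «(b)-WT4-ASSEMBLY-∀j», FINAL FORM — the weighted clause at EVERY level modulo STRUCTURAL E1 INPUTS, NUMERICS AND CAPS, NO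
# KIT-CURRENCY ROW — with «D-ORDER» CURED (located by p4 g22 KL STATUS l.11984; pen (R411)(C), (R416)(B)(2)) and the six-leg side in SECTORISED currency
# («(b)-WT4-6LEG-CURRENCY», located by k3c2-p3 g17 l.12210 / T2-2 l.12218; pen (R416)); the three ♯3 cures (READOUT-CE-DIM, BLOCK0-RATE, E-b1-2LEG-SHAPE) kept
# Route `KLProgramme` — crux K3 ENGINE (stmt-HubbardSuperconductivity-20437 `KLRegimeEngineV17F2`), stub (b) v2, THE WEIGHTED HALF «(b)-WT4»
# (cell gate-hubbard-kl, seat hubbard-kl-k3c3-p2 g18; = final♯3 `kernelNormsWt4_all_klEng_final_sharp3` (p713035) re-keyed on file E `kernelNormsWt4_all_klEng_closed_sharp4`;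
#  the level-0 datum discharge (W13 `exists_levelZeroDatumWt_klEng`, p3's `exists_levelZeroDatum_klEng`, §1 `towerV_mono_Icc` / `kitRowsWt_of_unitLaw` of W14) verbatim)

THE TWO CHANGES vs `_final_sharp3` (every other binder token-identical):
* «D-ORDER» — HEAD SHAPE `(R c″) (hc″) : ∃ C₁ C₂ Cκ CJ C₁r C₂r Cκr CJr C₁i C₂i > 0, ∃ C₆c > 0, ∀ d : ℕ, ∃ Cb Cbr > 0, ∃ Cinc₁ Dinc₁ ≥ 1, ∃ Cκ₀ CJ₀ Cα > 0, ∃ Cκz Cbz CJz > 0,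
  ∃ CWi CW₄ > 0, ∃ Cinc₂ Dinc₂ ≥ 1, ∃ Cκ₁ CJ₁ Cα₁ > 0, (R.WF2 → ∃ c₃′ U₀′ > 0, ∀ P, P.WF → ∃ A₁ P₁ T₁ A₁′ P₁′ T₁′ > 0, ∃ c₀ U₁ > 0, ∀ G Q c, … 2 ≤ d → …)`:
  the law's `C₂` and BOTH overlap constants `CJ CJr` — which pin `c̄c ≥ 162·max(CJ,CJr)·M/β`, hence `Z = ε_x²c̄c²/8` and the blocking row `Z·C₂²·2^{−(d−1)}·max Q′ Qb ≤ Q″`,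
  `4Q″ ≤ Q′`, `2τψQ″ ≤ Q′` (`2τψ = 8e⁴`) — are now in hand BEFORE the numerics choose the block length `d ≥ d₀(C₂, CJ, CJr)`; after `d` come only the two alpha
  constants `Cb Cbr` (dominant `Cb·(M/β)·4^d/klE0 ≤ ᾱ`), p3's block-0 constants, the Z-thread's, k3c2-p3's `CWi`, the common four-leg cell constant and W11b's.
* «2LEG-CURRENCY» (face of record (R431) «(C1″)-TWO-LEG-CELLS-AT-THE-INPUT-FAMILY»; located «(b)-WT4-2LEG-PLAIN-CURRENCY», k3c2-p3 g18: the PLAIN two-leg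
  line of `𝒱_{dk}[K_n]` is ≥ `|Im Σ_{>Λ_{dk}}(iω,k_F)| ≍ 0.019·U²` dk-uniformly, so a `4^{−dk}` plain bound is unfillable) — the two-leg IMPORT binder is the SECTORISED
  two-leg cell AT THE INPUT FAMILY, `∀ q w, klWtPinnedSumOf … (K_n) (dk−1) 2 (klEffectiveAction … (K_n) klE0 (dk)) q w ≤ S₂·(4^{dk−1})⁻¹` (λ-free c-class, (R403)'s
  price reading preserved), read into the kit's two-leg row by k3c2-p3's `importRowTwo_of_inputFamilyCell` (✓ p717660) with `i₁ j = 2·W·Z·(S₂/λ_j)`, `ι₁ j = i₁ j·(M/β)`;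
  the FOUR-leg import stays the weighted PLAIN line `s₄·λ_j` (U-class at natural size; no located defect).
* «6LEG-CURRENCY» (faces of record (R425)(3) «(C1′)-CELLS-AT-THE-INPUT-FAMILY» + (R423)(C) «(D1)»; located «(R1)-COARSENING-READER-UNSOUND» k3c2-p3 g17: an
  own-family cell is blind to the annulus `Λ_j ≤ t < Λ_{j−1}` that the tower's input family sees) — the six-leg side is ONE E1 family: the SECTORISED six-leg cell of
  `𝒱_j[K_n]` AT THE INPUT FAMILY `F_{j−1}`, `∀ q w, klWtPinnedSumOf … (K_n) (j−1) 6 (klEffectiveAction … (K_n) klE0 j) q w ≤ S₆·ε_j²·2^{4j}` (`d ≤ j ≤ n`; `S₆ ≥ 0` FREE, fixed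
  before the numerics, never the consumer's `Qe.CE³` — p3 g23's α1-loop test; STATUS (census rider «SIX-LEG-CELL-STATUS», (R429)): an r2-CLASS OPEN E1 estimate on
  the correlated-counting track, NOT a transcription of BGM 2006 (2.77)); from it file D DERIVES the six-leg IMPORT row of every
  block `k ≥ 2` (k3c2-p3's `importRowSix_of_inputFamilyCell`, ✓ p715234 §1) under the domination `512·W·Z³·S₆·(M/β)⁵ ≤ ι₃` and the level's OWN-family `m = 6` clause by
  one refinement level (`klWtPinnedSum_six_le_of_inputFamilyCell_klEng_flow_all`, §2; `C₆c` d-free) under the threshold `C₆c·16·S₆ ≤ Qe.CE³`; block 1's import was read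
  off p3's base law at `p = 3` in file C under `W·Z³·(Ab·Qb³) ≤ ι₃`; `s₆ S₆(j) x₆ CW₆`, `ι₃ = x₆·(M/β)⁵`, the six-leg count and threshold rows are GONE — `ι₃` is a NAME under
  the two dominations [numerics].
* **`kernelNormsWt4_all_klEng_final_sharp4C2 (R c″)`** ⊢ `∀ j ≤ n, KernelNormsWt4 L M (klWtBudget P Qe U j) β U μ (klFlowFrameU L M β U μ n) j`.
INPUT CLASSES after this file (exhaustive): [E1 structural] the input-family SECTORISED two-leg cells (`S₂`, λ-free c-class, `4^{−(dk−1)}`) and the `klScaleWt_j`-weighted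
PLAIN four-leg (`s₄·λ_j`) pinned lines of the imports `𝒱_{dk}[K_n]` (blocks `d·k ≤ j`, rates `d ≤ j ≤ n`) and the four-leg lines of the cells `𝒱_j[K_n]` (`S₄`, `1 ≤ j ≤ n`); the input-family SECTORISED
six-leg cells `≤ S₆·ε_j²·2^{4j}` (`d ≤ j ≤ n`, `S₆ ≥ 0` free); blocking `d ≥ 2`, `B ≥ 1`; [numerics, p4] the doors (`c ≤ klEngC₃6 ⊓ c₃′ ⊓ c₀`,
`U ≤ klEngU₀9 ⊓ U₀′ ⊓ U₁`, `c″U ≤ 1`), dominants `κb αb crb ccb` (8 inequalities), names `W Z σ τ ψ Φ`, `A′ Q″` (4 dominations, `0 < Q″`), the two `ι₃` dominations, the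
six-leg threshold `C₆c·16·S₆ ≤ Qe.CE³`, the 8 kit rows at every `λ_j` (`d ≤ j ≤ n`), `Atot Qtot` (equational) + CE row, `(klEngQ7 P R).IsRaiseOf Qe`; block 0: names `Ab₀ Qb₀` and two name groups (equational),
`A′_g ≥ 0, Q′_g > 0, ι_g`, three dominations per group, majorant arrays `ν₀ ν₁` (three domination rows each) and `ν_z` (three rows), per-rate bundles (group 0 ONCE at
`λ_d` under `d ≤ n`; group 1 at `1 ≤ j ≤ d−1`), the Z-thread names + guard (under `d ≤ n`), read-out names `Aro Qro Qtot Atot` ×2 (equational) + two CE rows,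
`(d ≤ n → Atot₁ ≤ Ab)`, `Qtot₁ = Qb`, the four-leg cell threshold; [D] `D ≥ 3` and the three caps.
Bookkeeping composition of landed theorems and real algebra; nothing asserts (b), WT4's rows, (ℓ), any stub, K3 or superconductivity.
References: BGM 2006 §2.3 (2.13)–(2.14), §2.7 (2.71a), (2.77)–(2.81), §2.8 (2.76)–(2.84), (2.93)–(2.98), Lemma 2.5, §3 (3.2)–(3.8) [cite: BenfattoGiulianiMastropietro2006].
-/

noncomputable section

namespace Summit.HubbardSuperconductivity.HubbardSuperconductivity.Theorems.EngineV8

set_option linter.dupNamespace false -- summit = problem name (single-conjunct summit), D-0017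

open Classical
open Real Finset Literature.MathematicalPhysics.QuantumLattice Literature.Probability.LatticeModels GrassmannAlgebra
open Literature.MathematicalPhysics.QuantumLattice.FermiRG Literature.MathematicalPhysics.QuantumLattice.FermiRG.BGM2006Routing
open Summit.HubbardSuperconductivity.HubbardSuperconductivity.Theorems.KLProgrammeLegKernels
open Summit.HubbardSuperconductivity.HubbardSuperconductivity.Theorems.KLRegimeSplit
open Summit.HubbardSuperconductivity.HubbardSuperconductivity.Theorems.KLRegimeWick
open Summit.HubbardSuperconductivity.HubbardSuperconductivity.Theorems.TwoPointAssembly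
open Summit.HubbardSuperconductivity.HubbardSuperconductivity.Theorems.DispersionFlow
open Summit.HubbardSuperconductivity.HubbardSuperconductivity.Theorems.TorusFourierL2

variable {L M : ℕ} [NeZero L] [NeZero M]



/-! ## The weighted clause at every level, modulo structural E1 inputs, numerics and caps — no kit-currency row — ♯4 HEAD -/

set_option maxHeartbeats 400000 in -- two ~60-binder kit bundles instantiated inside one ~250-binder composition (default × 2), as final♯3
/-- **STUB (b)'s WEIGHTED CLAUSE ON THE FLOW FRAME — EVERY LEVEL, MODULO STRUCTURAL E1 INPUTS, NUMERICS AND CAPS, NO KIT-CURRENCY ROW, ♯4 HEAD** («D-ORDER»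
cured: `∃ C₁ C₂ Cκ CJ C₁r C₂r Cκr CJr C₁i C₂i C₆c` BEFORE `∀ d`; the six-leg side = ONE input-family sectorised cell under a free amplitude (faces (C1′)+(D1)), `ι₃`
under two dominations; see the module docstring for the exhaustive input list); conclusion `∀ j ≤ n, KernelNormsWt4 L M (klWtBudget P Qe U j) β U μ (klFlowFrameU L M β U μ n) j`.
[cite: BenfattoGiulianiMastropietro2006, §2.3 (2.13)-(2.14), §2.7 (2.71a), (2.77)-(2.81), §2.8 (2.76)-(2.84), (2.93)-(2.98), Lemma 2.5 (2.98), §3 (3.2)-(3.8)] -/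
theorem kernelNormsWt4_all_klEng_final_sharp4C2 (R : RenConsts) (c'' : ℝ) (hc'' : 0 < c'') :
    ∃ C₁ C₂ Cκ CJ C₁r C₂r Cκr CJr C₁i C₂i : ℝ, 0 < C₁ ∧ 0 < C₂ ∧ 0 < Cκ ∧ 0 < CJ ∧
      0 < C₁r ∧ 0 < C₂r ∧ 0 < Cκr ∧ 0 < CJr ∧ 0 < C₁i ∧ 0 < C₂i ∧ ∃ C₆c : ℝ, 0 < C₆c ∧
      ∀ d : ℕ, ∃ Cb Cbr : ℝ, 0 < Cb ∧ 0 < Cbr ∧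
      ∃ Cinc₁ Dinc₁ : ℝ, 1 ≤ Cinc₁ ∧ 1 ≤ Dinc₁ ∧ ∃ Cκ₀ CJ₀ Cα : ℝ, 0 < Cκ₀ ∧ 0 < CJ₀ ∧ 0 < Cα ∧
      ∃ Cκz Cbz CJz : ℝ, 0 < Cκz ∧ 0 < Cbz ∧ 0 < CJz ∧ ∃ CWi CW₄ : ℝ, 0 < CWi ∧ 0 < CW₄ ∧
      ∃ Cinc₂ Dinc₂ : ℝ, 1 ≤ Cinc₂ ∧ 1 ≤ Dinc₂ ∧ ∃ Cκ₁ CJ₁ Cα₁ : ℝ, 0 < Cκ₁ ∧ 0 < CJ₁ ∧ 0 < Cα₁ ∧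
      (R.WF2 → ∃ c₃' : ℝ, 0 < c₃' ∧ ∃ U₀' : ℝ, 0 < U₀' ∧
      ∀ P : SplitConsts, P.WF → ∃ A₁ P₁ T₁ A₁' P₁' T₁' : ℝ, 0 < A₁ ∧ 0 < P₁ ∧ 0 < T₁ ∧ 0 < A₁' ∧ 0 < P₁' ∧ 0 < T₁' ∧
      ∃ c₀ : ℝ, 0 < c₀ ∧ ∃ U₁ : ℝ, 0 < U₁ ∧
      ∀ (G : GeoConsts) (Q : EngConsts) (c : ℝ), 0 < c → c ≤ klEngC₃6 P R → c ≤ c₃' → c ≤ c₀ →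
      ∀ μ ∈ klWindowC, ∀ U : ℝ, 0 < U → U ≤ klEngU₀9 P R c → U ≤ U₀' → U ≤ U₁ → c'' * U ≤ 1 →
      ∀ β : ℝ, klBetaMin ≤ β → β ≤ Real.exp (c / U ^ 2) →
      ∀ (L M : ℕ) [NeZero L] [NeZero M], klEngL₃ β U ≤ L → klEngM₃ β U L ≤ M →
      ∀ n : ℕ, 1 ≤ n → n ≤ nScales β + 1 → IsKLRegime U c (-(n : ℤ)) → HistP klPredsV17F2 L M G P Q R β U μ 0 n →
        (∀ m', 1 ≤ m' → m' < n → FlowPieceOscAt L M c'' β U μ m') →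
      2 ≤ d →
      -- the degree caps [choice: `exists_degreeCap`] (+ block `0`'s input family `F_0`)
      ∀ D : ℕ, 3 ≤ D → (∀ k, 1 ≤ k → d * k ≤ n → Fintype.card (SpaceTimeIdx L M × SectorLeg (sectorCount (d * k - 1))) / 2 ≤ D) →
        Fintype.card (HubbardFieldIdx L M) ≤ 2 * D + 1 → Fintype.card (SpaceTimeIdx L M × SectorLeg (sectorCount 0)) / 2 ≤ D →
      -- the coupling amplitude and the law's constants
      ∀ (B A Q' Ab Qb : ℝ), 1 ≤ B → 0 ≤ A → 0 < Q' → 0 ≤ Ab → 0 ≤ Qb →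
      -- THE LEVEL-0 WEIGHTED DATUM'S AMPLITUDE NAMES (W13, equational); BLOCK 0's BASE LAW (p3 WB3): names (group 0), dominations, majorant array, numerics ONCE at `λ_d` (under `d ≤ n`)
      ∀ (Ab₀ Qb₀ : ℝ), Ab₀ = A₁ * imagTimeWeight β M / P.Klam ^ 2 / B ^ 2 → Qb₀ = P₁ / imagTimeWeight β M ^ 2 →
      ∀ (αb₀ κb₀ crb₀ ccb₀ W₀ Z₀ σ₀ τ₀ ψ₀ Φ₀ : ℝ), αb₀ = Cα * ((M : ℝ) / β) → κb₀ = Real.sqrt (2 * Cκ₀ * klE0) → crb₀ = 81 * CJ₀ * M / β →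
        ccb₀ = 162 * CJ₀ * M / β → W₀ = 32 * crb₀ / ccb₀ → Z₀ = imagTimeWeight β M ^ 2 * ccb₀ ^ 2 / 8 → σ₀ = κb₀ ^ 2 / ccb₀ ^ 2 →
        τ₀ = 4 * exp 4 * κb₀ ^ 2 / ccb₀ ^ 2 → ψ₀ = ccb₀ ^ 2 / κb₀ ^ 2 → Φ₀ = exp 1 * αb₀ * ccb₀ / (κb₀ ^ 2 * crb₀) →
      ∀ (A'₀ Q'₀ ι₁₀ ι₂₀ ι₃₀ : ℝ), 0 ≤ A'₀ → 0 < Q'₀ →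
      W₀ * Ab₀ ≤ A'₀ → Z₀ * Qb₀ ≤ Q'₀ → W₀ * Z₀ ^ 3 * Ab₀ * Qb₀ ^ 3 ≤ ι₃₀ →
      ∀ ν₀ : ℕ → ℝ, (∀ m, 3 ≤ m → W₀ * Z₀ ^ m * (Ab₀ * (B * epsCoupling P U d) ^ (m - 1) * Qb₀ ^ m) ≤ ν₀ m) →
        W₀ * Z₀ ^ 1 * (T₁ * (|U| + c) / imagTimeWeight β M) ≤ ν₀ 1 →
        W₀ * Z₀ ^ 2 * (A₁ * P₁ ^ 2 * |U| / imagTimeWeight β M ^ 3) ≤ ν₀ 2 →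
      (d ≤ n →
        W₀ * Z₀ ^ 1 * (T₁ * (|U| + c) / imagTimeWeight β M) ≤ ι₁₀ * (B * epsCoupling P U d) ∧
        W₀ * Z₀ ^ 2 * (A₁ * P₁ ^ 2 * |U| / imagTimeWeight β M ^ 3) ≤ ι₂₀ * (B * epsCoupling P U d) ∧
        4 * σ₀ * (B * epsCoupling P U d) * Q'₀ < 1 ∧ 2 * (B * epsCoupling P U d) * τ₀ * Q'₀ ≤ 1 ∧ exp 1 * τ₀ * (B * epsCoupling P U d) * Q'₀ < 1 ∧
        Φ₀ * (τ₀ * (ι₁₀ * (B * epsCoupling P U d) + ι₂₀ / (2 * Q'₀) + ι₃₀ / (4 * Q'₀ ^ 2) + A'₀ * Q'₀ / 4)) < 1 ∧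
        Φ₀ * (exp 1 * τ₀ * (ι₁₀ * (B * epsCoupling P U d)) + (exp 1 * τ₀) ^ 2 * (ι₂₀ * (B * epsCoupling P U d)) +
          (exp 1 * τ₀) ^ 3 * (ι₃₀ * (B * epsCoupling P U d) ^ 2) +
          A'₀ * (exp 1 * τ₀ * Q'₀) * ((exp 1 * τ₀ * (B * epsCoupling P U d) * Q'₀) ^ 3 / (1 - exp 1 * τ₀ * (B * epsCoupling P U d) * Q'₀))) < 1 ∧
        Φ₀ * towerV D τ₀ ν₀ < 1) →
      ∀ (Aro₁ Qro₁ Qtot₁ Atot₁ : ℝ), Aro₁ = Cinc₁ * Ab₀ → Qro₁ = Dinc₁ * Qb₀ →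
        Qtot₁ = Dinc₁ * max 1 (max Qro₁ (max (4 * Q'₀) (2 * τ₀ * ψ₀ * Q'₀))) →
        (Atot₁ = Aro₁ + Cinc₁ * (A'₀ * (4 * σ₀ * (B * epsCoupling P U d) * Q'₀ / (1 - 4 * σ₀ * (B * epsCoupling P U d) * Q'₀)) +
          exp 1 * (τ₀ * (ι₁₀ * (B * epsCoupling P U d) + ι₂₀ / (2 * Q'₀) + ι₃₀ / (4 * Q'₀ ^ 2) + A'₀ * Q'₀ / 4)) *
            (Φ₀ * (τ₀ * (ι₁₀ * (B * epsCoupling P U d) + ι₂₀ / (2 * Q'₀) + ι₃₀ / (4 * Q'₀ ^ 2) + A'₀ * Q'₀ / 4)) /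
              (1 - Φ₀ * (τ₀ * (ι₁₀ * (B * epsCoupling P U d) + ι₂₀ / (2 * Q'₀) + ι₃₀ / (4 * Q'₀ ^ 2) + A'₀ * Q'₀ / 4)))) / (2 * τ₀ * Q'₀))) →
        (d ≤ n → Atot₁ ≤ Ab) → Qtot₁ = Qb →
      -- BLOCK 0's Z-THREAD (p3 `towerZ_blockZero_klEng`): its four names, a majorant array of the PLAIN level-0 datum (p3's `exists_levelZeroDatum_klEng`, at `λ_1`)
      -- and the PLAIN kit guard on it [numerics; read only when `d ≤ n`]
      ∀ (κz αz crz ccz : ℝ), κz = Real.sqrt (2 * Cκz * klE0) → αz = Cbz * ((M : ℝ) / β) * (4 : ℝ) ^ d / klE0 →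
        crz = 81 * CJz * M / β → ccz = 162 * CJz * M / β →
      ∀ νz : ℕ → ℝ, (27 : ℝ) ^ 5 * (T₁' * (|U| + c) / imagTimeWeight β M) ≤ νz 1 → (27 : ℝ) ^ 5 * (A₁' * P₁' ^ 2 * |U| / imagTimeWeight β M ^ 3) ≤ νz 2 →
        (∀ m, 3 ≤ m → (27 : ℝ) ^ 5 * (A₁' * imagTimeWeight β M / P.Klam ^ 2 / B ^ 2) * (B * epsCoupling P U 1) ^ (m - 1) * (P₁' / imagTimeWeight β M ^ 2) ^ m ≤ νz m) →
      (d ≤ n → 9 * αz * ccz / ((27 : ℝ) ^ 5 * exp 1 * κz ^ 2 * crz) *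
        towerV D (exp 2 * κz ^ 2 / ccz ^ 2)
          (fun m => 64 * (27 : ℝ) ^ 4 * exp 2 * crz / ccz * (exp 4 * ccz ^ 2 * imagTimeWeight β M ^ 2 / 8) ^ m * νz m) < 1) →
      -- BLOCK 0's LEVELS `1 ≤ j < d` (W11b at `d−1`): names (group 1, equational), dominations, majorant array, numerics at `λ_j`, `1 ≤ j ≤ d − 1`
      ∀ (αb₁ κb₁ crb₁ ccb₁ W₁ Z₁ σ₁ τ₁ ψ₁ Φ₁ : ℝ), αb₁ = Cα₁ * ((M : ℝ) / β) → κb₁ = Real.sqrt (2 * Cκ₁ * klE0) → crb₁ = 81 * CJ₁ * M / β →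
        ccb₁ = 162 * CJ₁ * M / β → W₁ = 32 * crb₁ / ccb₁ → Z₁ = imagTimeWeight β M ^ 2 * ccb₁ ^ 2 / 8 → σ₁ = κb₁ ^ 2 / ccb₁ ^ 2 →
        τ₁ = 4 * exp 4 * κb₁ ^ 2 / ccb₁ ^ 2 → ψ₁ = ccb₁ ^ 2 / κb₁ ^ 2 → Φ₁ = exp 1 * αb₁ * ccb₁ / (κb₁ ^ 2 * crb₁) →
      ∀ (A'₁ Q'₁ ι₁₁ ι₂₁ ι₃₁ : ℝ), 0 ≤ A'₁ → 0 < Q'₁ →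
      W₁ * Ab₀ ≤ A'₁ → Z₁ * Qb₀ ≤ Q'₁ → W₁ * Z₁ ^ 3 * Ab₀ * Qb₀ ^ 3 ≤ ι₃₁ →
      ∀ ν₁ : ℕ → ℕ → ℝ, (∀ j m, 3 ≤ m → W₁ * Z₁ ^ m * (Ab₀ * (B * epsCoupling P U j) ^ (m - 1) * Qb₀ ^ m) ≤ ν₁ j m) →
        (∀ j, W₁ * Z₁ ^ 1 * (T₁ * (|U| + c) / imagTimeWeight β M) ≤ ν₁ j 1) →
        (∀ j, W₁ * Z₁ ^ 2 * (A₁ * P₁ ^ 2 * |U| / imagTimeWeight β M ^ 3) ≤ ν₁ j 2) →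
      (∀ j, 1 ≤ j → j ≤ d - 1 → j ≤ n →
        W₁ * Z₁ ^ 1 * (T₁ * (|U| + c) / imagTimeWeight β M) ≤ ι₁₁ * (B * epsCoupling P U j) ∧
        W₁ * Z₁ ^ 2 * (A₁ * P₁ ^ 2 * |U| / imagTimeWeight β M ^ 3) ≤ ι₂₁ * (B * epsCoupling P U j) ∧
        4 * σ₁ * (B * epsCoupling P U j) * Q'₁ < 1 ∧ 2 * (B * epsCoupling P U j) * τ₁ * Q'₁ ≤ 1 ∧ exp 1 * τ₁ * (B * epsCoupling P U j) * Q'₁ < 1 ∧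
        Φ₁ * (τ₁ * (ι₁₁ * (B * epsCoupling P U j) + ι₂₁ / (2 * Q'₁) + ι₃₁ / (4 * Q'₁ ^ 2) + A'₁ * Q'₁ / 4)) < 1 ∧
        Φ₁ * (exp 1 * τ₁ * (ι₁₁ * (B * epsCoupling P U j)) + (exp 1 * τ₁) ^ 2 * (ι₂₁ * (B * epsCoupling P U j)) +
          (exp 1 * τ₁) ^ 3 * (ι₃₁ * (B * epsCoupling P U j) ^ 2) +
          A'₁ * (exp 1 * τ₁ * Q'₁) * ((exp 1 * τ₁ * (B * epsCoupling P U j) * Q'₁) ^ 3 / (1 - exp 1 * τ₁ * (B * epsCoupling P U j) * Q'₁))) < 1 ∧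
        Φ₁ * towerV D τ₁ (ν₁ j) < 1) →
      ∀ (Aro₂ Qro₂ Qtot₂ : ℝ) (Atot₂ : ℕ → ℝ), Aro₂ = Cinc₂ * Ab₀ → Qro₂ = Dinc₂ * Qb₀ →
        Qtot₂ = Dinc₂ * max 1 (max Qro₂ (max (4 * Q'₁) (2 * τ₁ * ψ₁ * Q'₁))) →
        (∀ j, Atot₂ j = Aro₂ + Cinc₂ * (A'₁ * (4 * σ₁ * (B * epsCoupling P U j) * Q'₁ / (1 - 4 * σ₁ * (B * epsCoupling P U j) * Q'₁)) +
          exp 1 * (τ₁ * (ι₁₁ * (B * epsCoupling P U j) + ι₂₁ / (2 * Q'₁) + ι₃₁ / (4 * Q'₁ ^ 2) + A'₁ * Q'₁ / 4)) *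
            (Φ₁ * (τ₁ * (ι₁₁ * (B * epsCoupling P U j) + ι₂₁ / (2 * Q'₁) + ι₃₁ / (4 * Q'₁ ^ 2) + A'₁ * Q'₁ / 4)) /
              (1 - Φ₁ * (τ₁ * (ι₁₁ * (B * epsCoupling P U j) + ι₂₁ / (2 * Q'₁) + ι₃₁ / (4 * Q'₁ ^ 2) + A'₁ * Q'₁ / 4)))) / (2 * τ₁ * Q'₁))) →
      -- dominants of the LINK's and of the read-out's constants, and the names
      ∀ (κb αb crb ccb : ℝ), Real.sqrt (2 * Cκ * klE0) ≤ κb → Cb * ((M : ℝ) / β) * (4 : ℝ) ^ d / klE0 ≤ αb →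
        81 * CJ * M / β ≤ crb → 162 * CJ * M / β ≤ ccb →
        Real.sqrt (2 * Cκr * klE0) ≤ κb → Cbr * ((M : ℝ) / β) * (4 : ℝ) ^ d / klE0 ≤ αb → 81 * CJr * M / β ≤ crb → 162 * CJr * M / β ≤ ccb →
      ∀ (W Z σ τ ψ Φ : ℝ),
        W = 32 * crb / ccb → Z = imagTimeWeight β M ^ 2 * ccb ^ 2 / 8 →
        σ = κb ^ 2 / ccb ^ 2 → τ = 4 * exp 4 * κb ^ 2 / ccb ^ 2 → ψ = ccb ^ 2 / κb ^ 2 → Φ = exp 1 * αb * ccb / (κb ^ 2 * crb) →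
      ∀ (A' Q'' : ℝ),
        W * ((C₁ / C₂) * (8 : ℝ) ^ (d - 1) * (Ab + A / (1 - ((2 : ℝ) ^ d)⁻¹))) ≤ A' →
        Z * (C₂ ^ 2 * ((2 : ℝ) ^ (d - 1))⁻¹ * max Q' Qb) ≤ Q'' → W * Ab ≤ A' → Z * Qb ≤ Q'' → 0 < Q'' →
      -- the weighted IMPORTS [E1]: the two-leg SECTORISED cell of `𝒱_{dk}[K_n]` AT THE INPUT FAMILY `F_{dk−1}`, λ-free c-class `S₂·4^{−(dk−1)}` ((R431) (C1″))
      -- and the `klScaleWt_j`-weighted PLAIN four-leg pinned line `s₄·λ_j`, every block `d·k ≤ j`, every rate `d ≤ j ≤ n`;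
      -- the six-leg side = ONE family, the SECTORISED six-leg cell of `𝒱_j[K_n]` AT THE INPUT FAMILY `F_{j−1}` under a FREE amplitude `S₆·ε_j²·2^{4j}`, `d ≤ j ≤ n`
      -- ((R425)(3) (C1′) + (R423)(C) (D1); status: r2-CLASS OPEN E1 estimate per census rider «SIX-LEG-CELL-STATUS» (R429), NOT a transcription of BGM 2006 (2.77))
      -- — feeding the imports of the blocks `k ≥ 2` and the level's own `m = 6` clause (file D)
      ∀ (S₂ s₄ S₆ : ℝ), 0 ≤ S₂ → 0 ≤ s₄ → 0 ≤ S₆ →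
      (∀ j, d ≤ j → j ≤ n → ∀ k, 1 ≤ k → d * k ≤ j → ∀ (q : Fin 2) (w : SpaceTimeIdx L M × SectorLeg (sectorCount (d * k - 1))),
        klWtPinnedSumOf L M β μ (klFlowFrameU L M β U μ n) (d * k - 1) 2 (klEffectiveAction L M β U μ (klFlowFrameU L M β U μ n) klE0 (d * k)) q w ≤
          S₂ * ((4 : ℝ) ^ (d * k - 1))⁻¹) →
      (∀ j, d ≤ j → j ≤ n → ∀ k, 1 ≤ k → d * k ≤ j → ∀ (q : Fin 4) (τ' : Fin 4 → SectorLeg 1) (y' : SpaceTimeIdx L M),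
        imagTimeWeight β M ^ 3 * ∑ x' ∈ univ.filter (fun x' : Fin 4 → SpaceTimeIdx L M => x' q = y'),
          klScaleWt L M β j ((univ.image x').image (fun x : SpaceTimeIdx L M => (((((2 * (x.1 : ℕ) : ℕ)) : ZMod (2 * (2 * M)))), x.2))) *
            ‖sectorisedKernel L M β (trivialMultiplier L M) (klTowerInput L M β U μ (klFlowFrameU L M β U μ n) d k) 4 τ' x'‖ ≤ s₄ * (B * epsCoupling P U j)) →
      (∀ j, d ≤ j → j ≤ n → ∀ (q : Fin 6) (w : SpaceTimeIdx L M × SectorLeg (sectorCount (j - 1))),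
        klWtPinnedSumOf L M β μ (klFlowFrameU L M β U μ n) (j - 1) 6 (klEffectiveAction L M β U μ (klFlowFrameU L M β U μ n) klE0 j) q w ≤
          S₆ * epsCoupling P U j ^ 2 * (2 : ℝ) ^ (4 * j)) →
      -- the import amplitudes they induce (two-leg `i₁ j = 2WZ·S₂/λ_j` by k3c2-p3's `importRowTwo_of_inputFamilyCell`; four-leg by the plain-line glue; six-leg: `ι₃` a NAME under two
      -- dominations [numerics] — block 1 from the base law, blocks `k ≥ 2` from the input-family cell `512·W·Z³·S₆·(M/β)⁵`)
      ∀ (i₁ ι₁ : ℕ → ℝ) (i₂ ι₂ ι₃ : ℝ), (∀ j, i₁ j = 2 * W * Z * (S₂ / (B * epsCoupling P U j))) →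
        i₂ = 16 * W * Z ^ 2 * klThinCountC * CWi ^ 4 * s₄ →
        (∀ j, ι₁ j = i₁ j * ((M : ℝ) / β)) → ι₂ = i₂ * ((M : ℝ) / β) ^ 3 → W * Z ^ 3 * (Ab * Qb ^ 3) ≤ ι₃ →
        512 * W * Z ^ 3 * S₆ * ((M : ℝ) / β) ^ 5 ≤ ι₃ →
      -- the kit's numerics at every read-out rate [p4 «part 4»]
      (∀ j, d ≤ j → j ≤ n →
        4 * σ * (B * epsCoupling P U j) * Q'' < 1 ∧ 2 * (B * epsCoupling P U j) * τ * Q'' ≤ 1 ∧ exp 1 * τ * (B * epsCoupling P U j) * Q'' < 1 ∧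
        Φ * (τ * (ι₁ j * (B * epsCoupling P U j) + ι₂ / (2 * Q'') + ι₃ / (4 * Q'' ^ 2) + A' * Q'' / 4)) < 1 ∧
        Φ * (exp 1 * τ * (ι₁ j * (B * epsCoupling P U j)) + (exp 1 * τ) ^ 2 * (ι₂ * (B * epsCoupling P U j)) +
          (exp 1 * τ) ^ 3 * (ι₃ * (B * epsCoupling P U j) ^ 2) +
          A' * (exp 1 * τ * Q'') * ((exp 1 * τ * (B * epsCoupling P U j) * Q'') ^ 3 / (1 - exp 1 * τ * (B * epsCoupling P U j) * Q''))) < 1 ∧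
        4 * Q'' ≤ Q' ∧ 2 * τ * ψ * Q'' ≤ Q' ∧
        A' * (4 * Q'') ^ 3 * (4 * σ * (B * epsCoupling P U j) * Q'' / (1 - 4 * σ * (B * epsCoupling P U j) * Q'')) +
          exp 1 * ψ * (2 * τ * ψ * Q'') ^ 2 * (τ * (ι₁ j * (B * epsCoupling P U j) + ι₂ / (2 * Q'') + ι₃ / (4 * Q'' ^ 2) + A' * Q'' / 4)) *
            (Φ * (τ * (ι₁ j * (B * epsCoupling P U j) + ι₂ / (2 * Q'') + ι₃ / (4 * Q'' ^ 2) + A' * Q'' / 4)) /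
              (1 - Φ * (τ * (ι₁ j * (B * epsCoupling P U j) + ι₂ / (2 * Q'') + ι₃ / (4 * Q'' ^ 2) + A' * Q'' / 4)))) ≤ A * Q' ^ 3) →
      -- the read-out constants level by level and the budget package's `CE` row [p4]
      ∀ (Qe : EngConsts) (Atot Qtot : ℕ → ℝ),
        (∀ j, Qtot j = max 1 (C₂i ^ 2) * max 1 (max (C₂r ^ 2 * max Q' Qb) (max (4 * Q'') (2 * τ * ψ * Q'')))) →
        (∀ j, Atot j = C₁r / C₂r * (Ab + A) + C₁i / C₂i * (A' * (4 * σ * (B * epsCoupling P U j) * Q'' / (1 - 4 * σ * (B * epsCoupling P U j) * Q'')) +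
          exp 1 * (τ * (ι₁ j * (B * epsCoupling P U j) + ι₂ / (2 * Q'') + ι₃ / (4 * Q'' ^ 2) + A' * Q'' / 4)) *
            (Φ * (τ * (ι₁ j * (B * epsCoupling P U j) + ι₂ / (2 * Q'') + ι₃ / (4 * Q'' ^ 2) + A' * Q'' / 4)) /
              (1 - Φ * (τ * (ι₁ j * (B * epsCoupling P U j) + ι₂ / (2 * Q'') + ι₃ / (4 * Q'' ^ 2) + A' * Q'' / 4)))) / (2 * τ * Q''))) →
        (∀ j, d ≤ j → j ≤ n → Qtot j * imagTimeWeight β M ^ 2 * B * max 1 (Atot j / imagTimeWeight β M) ≤ Qe.CE) →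
        (∀ j, 1 ≤ j → j ≤ d - 1 → j ≤ n → Qtot₂ * imagTimeWeight β M ^ 2 * B * max 1 (Atot₂ j / imagTimeWeight β M) ≤ Qe.CE) →
        (klEngQ7 P R).IsRaiseOf Qe →
      C₆c * 16 * S₆ ≤ Qe.CE ^ 3 →
      -- the four-leg import CELL at every `1 ≤ j ≤ n` — the weighted PLAIN four-leg pinned line of `𝒱_j[K_n]` at `(F_j, rate j)` [E1] + threshold [numerics]
      -- (the six-leg cell sits with the structural inputs above)
      ∀ (S₄ : ℕ → ℝ), (∀ j, 0 ≤ S₄ j) →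
      (∀ j, 1 ≤ j → j ≤ n → ∀ (q : Fin 4) (τ' : Fin 4 → SectorLeg 1) (y' : SpaceTimeIdx L M),
        imagTimeWeight β M ^ 3 * ∑ x' ∈ univ.filter (fun x' : Fin 4 → SpaceTimeIdx L M => x' q = y'),
          klScaleWt L M β j ((univ.image x').image (fun x : SpaceTimeIdx L M => (((((2 * (x.1 : ℕ) : ℕ)) : ZMod (2 * (2 * M)))), x.2))) *
            ‖sectorisedKernel L M β (trivialMultiplier L M) (klEffectiveAction L M β U μ (klFlowFrameU L M β U μ n) klE0 j) 4 τ' x'‖ ≤ S₄ j) →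
      (∀ j, 1 ≤ j → j ≤ n → klThinCountC * sectorCount j * (CW₄ ^ 4 * S₄ j) ≤ klWtBudget P Qe U j 4) →
      ∀ j, j ≤ n → KernelNormsWt4 L M (klWtBudget P Qe U j) β U μ (klFlowFrameU L M β U μ n) j) := by
  obtain ⟨C₁, C₂, Cκ, CJ, C₁r, C₂r, Cκr, CJr, C₁i, C₂i, hC₁, hC₂, hCκ, hCJ, hC₁r, hC₂r, hCκr, hCJr, hC₁i, hC₂i, C₆c, hC₆c, hclU⟩ :=
    kernelNormsWt4_all_klEng_closed_sharp4C2 R c'' hc''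
  refine ⟨C₁, C₂, Cκ, CJ, C₁r, C₂r, Cκr, CJr, C₁i, C₂i, hC₁, hC₂, hCκ, hCJ, hC₁r, hC₂r, hCκr, hCJr, hC₁i, hC₂i, C₆c, hC₆c, fun d => ?_⟩
  obtain ⟨Cb, Cbr, hCb, hCbr, Cinc₁, Dinc₁, hCinc₁, hDinc₁, Cκ₀, CJ₀, Cα, hCκ₀, hCJ₀, hCα, Cκz, Cbz, CJz, hCκz, hCbz, hCJz, CWi, CW₄, hCWi, hCW₄,
    Cinc₂, Dinc₂, hCinc₂, hDinc₂, Cκ₁, CJ₁, Cα₁, hCκ₁, hCJ₁, hCα₁, hall⟩ := hclU d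
  refine ⟨Cb, Cbr, hCb, hCbr, Cinc₁, Dinc₁, hCinc₁, hDinc₁, Cκ₀, CJ₀, Cα, hCκ₀, hCJ₀, hCα, Cκz, Cbz, CJz, hCκz, hCbz, hCJz, CWi, CW₄, hCWi, hCW₄,
    Cinc₂, Dinc₂, hCinc₂, hDinc₂, Cκ₁, CJ₁, Cα₁, hCκ₁, hCJ₁, hCα₁, fun hR2 => ?_⟩
  obtain ⟨c₃a, hc₃a, U₀a, hU₀a, hall'⟩ := hall hR2
  refine ⟨c₃a, hc₃a, U₀a, hU₀a, fun P hP => ?_⟩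
  obtain ⟨c₀, hc₀, U₁, hU₁, hall''⟩ := hall' P hP
  obtain ⟨A₁, P₁, T₁, hA₁, hP₁, hT₁, c₀w, hc₀w, U₀w, hU₀w, hdatW⟩ := exists_levelZeroDatumWt_klEng P R hP hR2
  obtain ⟨A₁', P₁', T₁', hA₁', hP₁', hT₁', c₀p, hc₀p, U₀p, hU₀p, hdatP⟩ := exists_levelZeroDatum_klEng P R hP hR2
  refine ⟨A₁, P₁, T₁, A₁', P₁', T₁', hA₁, hP₁, hT₁, hA₁', hP₁', hT₁', min c₀ (min c₀w c₀p), lt_min hc₀ (lt_min hc₀w hc₀p),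
    min U₁ (min U₀w U₀p), lt_min hU₁ (lt_min hU₀w hU₀p), ?_⟩
  intro G Q c hc hc6 hc₃' hcc₀ μ hμ U hU hU9 hU₀' hUU₁ hcU β hβmin hβc L M _ _ hL3 hM3 n hn1 hnN hkl hhist hosc hd D hD3 hD hcard hD0
    B A Q' Ab Qb hB hA hQ hAb hQb Ab₀ Qb₀ hAb₀ hQb₀ αb₀ κb₀ crb₀ ccb₀ W₀ Z₀ σ₀ τ₀ ψ₀ Φ₀ hαb₀ hκb₀ hcrb₀ hccb₀ hW₀ hZ₀ hσ₀ hτ₀ hψ₀ hΦ₀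
    A'₀ Q'₀ ι₁₀ ι₂₀ ι₃₀ hA'₀ hQ'₀ hdA₀ hdQ₀ hdι₀ ν₀ hν₀3 hν₀1 hν₀2 hblk0 Aro₁ Qro₁ Qtot₁ Atot₁ hAro₁ hQro₁ hQtot₁ hAtot₁ hAtotle hQtotQb
    κz αz crz ccz hκz hαz hcrz hccz νz hνz1 hνz2 hνz3 hguardz
    αb₁ κb₁ crb₁ ccb₁ W₁ Z₁ σ₁ τ₁ ψ₁ Φ₁ hαb₁ hκb₁ hcrb₁ hccb₁ hW₁ hZ₁eq hσ₁ hτ₁ hψ₁ hΦ₁ A'₁ Q'₁ ι₁₁ ι₂₁ ι₃₁ hA'₁ hQ'₁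
    hdA₁ hdQ₁ hdι₁ ν₁ hν₁3 hν₁1 hν₁2 hblk1 Aro₂ Qro₂ Qtot₂ Atot₂ hAro₂ hQro₂ hQtot₂ hAtot₂
    κb αb crb ccb hκb hαb hcrb hccb hκbr hαbr hcrbr hccbr W Z σ τ ψ Φ hW hZ' hσ hτ hψ hΦ
    A' Q'' hA'1 hQ'1 hA'2 hQ'2 hQ'0 S₂ s₄ S₆ hS₂0 hs₄ hS₆ hC2in hS₄ hC6in i₁ ι₁ i₂ ι₂ ι₃ hi₁ hi₂ hι₁ hι₂ hdomAQ hdomS hnum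
    Qe Atot Qtot hQtot hAtot hCE hCE₂ hQe hT6 S₄ hS₄0 hL4 hT4 j hjn
  -- the folded doors
  have hcc₀a : c ≤ c₀ := hcc₀.trans (min_le_left _ _)
  have hcc₀w : c ≤ c₀w := hcc₀.trans ((min_le_right _ _).trans (min_le_left _ _))
  have hcc₀p : c ≤ c₀p := hcc₀.trans ((min_le_right _ _).trans (min_le_right _ _))
  have hUU₁a : U ≤ U₁ := hUU₁.trans (min_le_left _ _)
  have hUU₁w : U ≤ U₀w := hUU₁.trans ((min_le_right _ _).trans (min_le_left _ _))
  have hUU₁p : U ≤ U₀p := hUU₁.trans ((min_le_right _ _).trans (min_le_right _ _))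
  have hβ : 0 < β := KLRegimeSplit.pos_of_klBetaMin_le hβmin
  have hK1 : 1 ≤ P.Klam := hP.1
  have hKl : 0 ≤ P.Klam := le_trans zero_le_one hK1
  have hB0 : 0 ≤ B := zero_le_one.trans hB
  have hM0 : (0 : ℝ) < M := Nat.cast_pos.2 (Nat.pos_of_ne_zero (NeZero.ne M))
  have he0 : (0 : ℝ) < klE0 := by norm_num [klE0]
  have hεx : 0 < imagTimeWeight β M := imagTimeWeight_pos_of_pos (M := M) hβ
  have hε0 : ∀ i, 0 ≤ epsCoupling P U i := fun i => epsCoupling_nonneg' hKl U i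
  have hfr : FrameOK R U (nScales β) μ (klFlowFrameU L M β U μ n) := frameOK_klFlowFrameU_of_histP_le hR2 hn1 le_rfl hnN hhist
  set K : TrigPolyC4v := klFlowFrameU L M β U μ n with hKdef
  have hAb₀0 : 0 ≤ Ab₀ := by rw [hAb₀]; positivity
  have hQb₀0 : 0 ≤ Qb₀ := by rw [hQb₀]; positivity
  -- the level-0 WEIGHTED datum at every rate (W13)
  have hdat := fun jr => hdatW c hc hcc₀w μ hμ U hU hU9 hUU₁w β hβmin hβc L M hL3 hM3 K hfr jr
  have hlawb₀ : ∀ j j', 1 ≤ j → j ≤ n → ∀ p : ℕ, 3 ≤ p →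
      klTowerMeasWtAt L M β U μ K 1 1 j (2 * p) / klLevUnitF β M 0 p 0 ≤ Ab₀ * (B * epsCoupling P U j') ^ (p - 1) * Qb₀ ^ p := by
    intro j j' _ _ p hp; rw [hAb₀, hQb₀]; exact (hdat j).1 B hB j' p hp
  -- the kit rows of a block-0 name group from the unit law, the dominations and the majorant array (§1)
  have hkit : ∀ (Wg Zg σg τg Φg A'g Q'g i1 i2 i3 αg κg crg ccg CJg Cκg Cαg : ℝ) (νg : ℕ → ℝ) (jc : ℕ),
      αg = Cαg * ((M : ℝ) / β) → κg = Real.sqrt (2 * Cκg * klE0) → crg = 81 * CJg * M / β → ccg = 162 * CJg * M / β →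
      Wg = 32 * crg / ccg → Zg = imagTimeWeight β M ^ 2 * ccg ^ 2 / 8 → τg = 4 * exp 4 * κg ^ 2 / ccg ^ 2 → Φg = exp 1 * αg * ccg / (κg ^ 2 * crg) →
      0 < CJg → 0 < Cκg → 0 < Cαg →
      Wg * Ab₀ ≤ A'g → Zg * Qb₀ ≤ Q'g → Wg * Zg ^ 3 * Ab₀ * Qb₀ ^ 3 ≤ i3 →
      (∀ m, 3 ≤ m → Wg * Zg ^ m * (Ab₀ * (B * epsCoupling P U jc) ^ (m - 1) * Qb₀ ^ m) ≤ νg m) →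
      Wg * Zg ^ 1 * (T₁ * (|U| + c) / imagTimeWeight β M) ≤ νg 1 →
      Wg * Zg ^ 2 * (A₁ * P₁ ^ 2 * |U| / imagTimeWeight β M ^ 3) ≤ νg 2 →
      ∀ j, 1 ≤ j → j ≤ n → (Wg * Zg ^ 1 * (T₁ * (|U| + c) / imagTimeWeight β M) ≤ i1 * (B * epsCoupling P U jc) ∧
        Wg * Zg ^ 2 * (A₁ * P₁ ^ 2 * |U| / imagTimeWeight β M ^ 3) ≤ i2 * (B * epsCoupling P U jc) ∧
        4 * σg * (B * epsCoupling P U jc) * Q'g < 1 ∧ 2 * (B * epsCoupling P U jc) * τg * Q'g ≤ 1 ∧ exp 1 * τg * (B * epsCoupling P U jc) * Q'g < 1 ∧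
        Φg * (τg * (i1 * (B * epsCoupling P U jc) + i2 / (2 * Q'g) + i3 / (4 * Q'g ^ 2) + A'g * Q'g / 4)) < 1 ∧
        Φg * (exp 1 * τg * (i1 * (B * epsCoupling P U jc)) + (exp 1 * τg) ^ 2 * (i2 * (B * epsCoupling P U jc)) +
          (exp 1 * τg) ^ 3 * (i3 * (B * epsCoupling P U jc) ^ 2) +
          A'g * (exp 1 * τg * Q'g) * ((exp 1 * τg * (B * epsCoupling P U jc) * Q'g) ^ 3 / (1 - exp 1 * τg * (B * epsCoupling P U jc) * Q'g))) < 1 ∧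
        Φg * towerV D τg νg < 1) →
      ((∀ m, 4 ≤ m → m ≤ D → Wg * Zg ^ m * (klTowerMeasWtAt L M β U μ K 1 1 j (2 * m) / klLevUnitF β M 0 m 0) ≤
          A'g * (B * epsCoupling P U jc) ^ (m - 1) * Q'g ^ m) ∧
        Wg * Zg ^ 3 * (klTowerMeasWtAt L M β U μ K 1 1 j (2 * 3) / klLevUnitF β M 0 3 0) ≤ i3 * (B * epsCoupling P U jc) ^ 2 ∧
        Wg * Zg ^ 1 * (klTowerMeasWtAt L M β U μ K 1 1 j (2 * 1) / klLevUnitF β M 0 1 0) ≤ i1 * (B * epsCoupling P U jc) ∧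
        Wg * Zg ^ 2 * (klTowerMeasWtAt L M β U μ K 1 1 j (2 * 2) / klLevUnitF β M 0 2 0) ≤ i2 * (B * epsCoupling P U jc) ∧
        4 * σg * (B * epsCoupling P U jc) * Q'g < 1 ∧ 2 * (B * epsCoupling P U jc) * τg * Q'g ≤ 1 ∧ exp 1 * τg * (B * epsCoupling P U jc) * Q'g < 1 ∧
        Φg * (τg * (i1 * (B * epsCoupling P U jc) + i2 / (2 * Q'g) + i3 / (4 * Q'g ^ 2) + A'g * Q'g / 4)) < 1 ∧
        Φg * (exp 1 * τg * (i1 * (B * epsCoupling P U jc)) + (exp 1 * τg) ^ 2 * (i2 * (B * epsCoupling P U jc)) +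
          (exp 1 * τg) ^ 3 * (i3 * (B * epsCoupling P U jc) ^ 2) +
          A'g * (exp 1 * τg * Q'g) * ((exp 1 * τg * (B * epsCoupling P U jc) * Q'g) ^ 3 / (1 - exp 1 * τg * (B * epsCoupling P U jc) * Q'g))) < 1 ∧
        Φg * towerV D τg (fun m => Wg * Zg ^ m * (klTowerMeasWtAt L M β U μ K 1 1 j (2 * m) / klLevUnitF β M 0 m 0)) < 1) := by
    intro Wg Zg σg τg Φg A'g Q'g i1 i2 i3 αg κg crg ccg CJg Cκg Cαg νg jc hαg hκg hcrg hccg hWg hZg hτg hΦg hCJg hCκg hCαg hdA hdQ hdι hν3 hν1 hν2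
      j hj1 hjn hb
    obtain ⟨hi1, hi2, hx1, hx2, hx3, hy, hθ, hg⟩ := hb
    have hκg0 : 0 < κg := by rw [hκg]; exact Real.sqrt_pos.2 (by positivity)
    have hcrg0 : 0 < crg := by rw [hcrg]; positivity
    have hccg0 : 0 < ccg := by rw [hccg]; positivity
    have hWg0 : 0 ≤ Wg := by rw [hWg]; positivity
    have hZg0 : 0 ≤ Zg := by rw [hZg]; positivity
    have hτg0 : 0 ≤ τg := by rw [hτg]; positivity
    have hαg0 : 0 ≤ αg := by rw [hαg]; positivity
    have hΦg0 : 0 ≤ Φg := by rw [hΦg]; positivity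
    obtain ⟨h4, h3, h1, h2, hgd⟩ := kitRowsWt_of_unitLaw (D := D) (μ := fun m => klTowerMeasWtAt L M β U μ K 1 1 j (2 * m) / klLevUnitF β M 0 m 0)
      (ν := νg) hWg0 hZg0 hτg0 hΦg0 hAb₀0 hQb₀0 (mul_nonneg hB0 (hε0 jc)) (fun m hm => hlawb₀ j jc hj1 hjn m hm) (hdat j).2.1 (hdat j).2.2
      hdA hdQ hdι hi1 hi2 (fun m hm => hν3 m hm) hν1 hν2 hg
    exact ⟨h4, h3, h1, h2, hx1, hx2, hx3, hy, hθ, hgd⟩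
  -- the two block-0 bundles in kit currency
  have hblk0' := fun j (hjd : d ≤ j) (hjn : j ≤ n) =>
    hkit W₀ Z₀ σ₀ τ₀ Φ₀ A'₀ Q'₀ ι₁₀ ι₂₀ ι₃₀ αb₀ κb₀ crb₀ ccb₀ CJ₀ Cκ₀ Cα ν₀ d hαb₀ hκb₀ hcrb₀ hccb₀ hW₀ hZ₀ hτ₀ hΦ₀ hCJ₀ hCκ₀ hCα hdA₀ hdQ₀ hdι₀
      hν₀3 hν₀1 hν₀2 j (by omega) hjn (hblk0 (hjd.trans hjn))
  have hblk1' := fun j (hj1 : 1 ≤ j) (hjd : j ≤ d - 1) (hjn : j ≤ n) =>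
    hkit W₁ Z₁ σ₁ τ₁ Φ₁ A'₁ Q'₁ ι₁₁ ι₂₁ ι₃₁ αb₁ κb₁ crb₁ ccb₁ CJ₁ Cκ₁ Cα₁ (ν₁ j) j hαb₁ hκb₁ hcrb₁ hccb₁ hW₁ hZ₁eq hτ₁ hΦ₁ hCJ₁ hCκ₁ hCα₁ hdA₁ hdQ₁ hdι₁
      (fun m hm => hν₁3 j m hm) (hν₁1 j) (hν₁2 j) j hj1 hjn (hblk1 j hj1 hjd hjn)
  -- the Z-thread's PLAIN guard from p3's plain datum majorants (towerV monotone)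
  have hguardz' : d ≤ n → 9 * αz * ccz / ((27 : ℝ) ^ 5 * exp 1 * κz ^ 2 * crz) *
      towerV D (exp 2 * κz ^ 2 / ccz ^ 2)
        (fun m => 64 * (27 : ℝ) ^ 4 * exp 2 * crz / ccz * (exp 4 * ccz ^ 2 * imagTimeWeight β M ^ 2 / 8) ^ m *
          klTowerMuLevF L M β U μ K 1 1 m) < 1 := by
    intro hdn
    obtain ⟨-, hm1, hm2, hm3⟩ := hdatP c hc hcc₀p μ hμ U hU hU9 hUU₁p β hβmin hβc L M hL3 hM3 K hfr
    have hκz0 : 0 < κz := by rw [hκz]; exact Real.sqrt_pos.2 (by positivity)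
    have hcrz0 : 0 < crz := by rw [hcrz]; positivity
    have hccz0 : 0 < ccz := by rw [hccz]; positivity
    have hαz0 : 0 ≤ αz := by rw [hαz]; positivity
    refine lt_of_le_of_lt (mul_le_mul_of_nonneg_left (towerV_mono_Icc (by positivity) fun m hm1' _ => ?_) (by positivity)) (hguardz hdn)
    refine mul_le_mul_of_nonneg_left ?_ (by positivity)
    rcases Nat.lt_or_ge m 3 with hm | hm
    · interval_cases m
      · exact hm1.trans hνz1
      · exact hm2.trans hνz2
    · exact (hm3 B hB 1 m hm).trans (hνz3 m hm)
  exact hall'' G Q c hc hc6 hc₃' hcc₀a μ hμ U hU hU9 hU₀' hUU₁a hcU β hβmin hβc L M hL3 hM3 n hn1 hnN hkl hhist hosc hd D hD3 hD hcard hD0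
    B A Q' Ab Qb hB hA hQ hAb hQb Ab₀ Qb₀ hAb₀0 hQb₀0 αb₀ κb₀ crb₀ ccb₀ W₀ Z₀ σ₀ τ₀ ψ₀ Φ₀ hαb₀ hκb₀ hcrb₀ hccb₀ hW₀ hZ₀ hσ₀ hτ₀ hψ₀ hΦ₀
    A'₀ Q'₀ ι₁₀ ι₂₀ ι₃₀ hA'₀ hQ'₀ hlawb₀ hblk0' Aro₁ Qro₁ Qtot₁ Atot₁ hAro₁ hQro₁ hQtot₁ hAtot₁ hAtotle hQtotQb
    κz αz crz ccz hκz hαz hcrz hccz hguardz'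
    αb₁ κb₁ crb₁ ccb₁ W₁ Z₁ σ₁ τ₁ ψ₁ Φ₁ hαb₁ hκb₁ hcrb₁ hccb₁ hW₁ hZ₁eq hσ₁ hτ₁ hψ₁ hΦ₁ A'₁ Q'₁ ι₁₁ ι₂₁ ι₃₁ hA'₁ hQ'₁ hblk1'
    Aro₂ Qro₂ Qtot₂ Atot₂ hAro₂ hQro₂ hQtot₂ hAtot₂
    κb αb crb ccb hκb hαb hcrb hccb hκbr hαbr hcrbr hccbr W Z σ τ ψ Φ hW hZ' hσ hτ hψ hΦ
    A' Q'' hA'1 hQ'1 hA'2 hQ'2 hQ'0 S₂ s₄ S₆ hS₂0 hs₄ hS₆ hC2in hS₄ hC6in i₁ ι₁ i₂ ι₂ ι₃ hi₁ hi₂ hι₁ hι₂ hdomAQ hdomS hnum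
    Qe Atot Qtot hQtot hAtot hCE hCE₂ hQe hT6 S₄ hS₄0 hL4 hT4 j hjn

end Summit.HubbardSuperconductivity.HubbardSuperconductivity.Theorems.EngineV8

end
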